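import Literature.NumberTheory.Rogawski1990.ArchLimitFormula
import Literature.NumberTheory.Automorphic.OrbitalMeasureQuotientOfPointHaarChange
import Literature.NumberTheory.Automorphic.ArchLocalRegularOrbitClosed
import HarnessLib

/-!
# The singular dictionary: class orbital integrals of a Weil-form family AT A WALL POINT are the letter's singular orbital integrals over the FIXED
# centraliser presentation — ROAD-Sd junction J2 (ii) «(V6)-compat ∕ singular dictionary» (Rogawski 1990 §1.7, §4.3 (4.3.1), §8.2)

Topic `NumberTheory/Rogawski1990` (§2, the carrier `G_w(β) = archLocal L 3 (diagonal β) w` of ★ `ArchLimitFormula` ∕ ★ `ArchStableTorusOrbitalWallDeriv`) over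
`NumberTheory/Automorphic` (§1, generic). THEOREMS ONLY (no definition, no instance, no notation, no named fact, no `sorry`). Cell `pub/hodgecm-mathlib`, ENGINE T1
(crux H413 = `stmt-HodgeConjecture-24833`); floor-1 glue under books row #88 (ST-∞) ∕ #111, count-neutral; p07 (g7)'s `CENSUS-ROAD-Sd-JUNCTION` d13cf214 §3 (a)(ii), shed to
F0P3a-p03 (g10) 03:42:07Z under LEAD F0P3a-plan (g9) WORD T8-38 (2); census `CENSUS-J2ii-SingularDictionary.F0P3a-p03g10.md` 9aafd70adab1ff6a.

WHY. The closer's archimedean singular orbital integrals are CLASS orbital integrals `Φ(⟦γ₀⟧, a; m)` of an orbital measure FAMILY `m` at a split-singular class (★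
`SingularEllipticTransfer(Canonical)` (ST-∞): `archStableOrbitalIntegral … mGis …`; the members `mGis` are ∃-bound and their archimedean mass is pinned only through the ADELIC Weil
form of (K7-s) — so NO intrinsic normalisation at `∞` is available and the family's point mass enters below as a HYPOTHESIS); the wall letters (J1 ★ `ArchStableTorusOrbitalWallDeriv`,
(J-nc) ★ `ArchLimitFormulaNoncompactWall`) produce the singular term as `∫_{G_w ⧸ H_w} Θ(y · diag z₀ · y⁻¹) d(ν ∕ νH)` over the FIXED wall subgroup `H_w = Z(diag z₁)` (a reference wall point
`z₁`, one Haar `νH` chosen once). This file is the bookkeeping between the two: «the orbital integrals are defined using compatible measures on `H_{γ′}` and `G_γ`» [§4.3 p. 43],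
«compatible = `c|Ω|` with the same `c`» [§1.7 p. 6].

* §1 GENERIC (`G` locally compact second countable T₂, Borel σ-algebras on `G` and on every `G ⧸ Z(g)`, `ν` a two-sided Haar measure, `f : G → ℂ`):
  (D1) `OrbitalMeasureFamily.classOrbitalIntegral_mk_eq_integral_descConj_of_atPoint_eq` — if `m.atPoint γ = dν ∕ dρ` (Weil form at the point) and `T = Z(γ)` is a closed presentation
  carrying `t_T` with `ρ = t_T ∘ (T = Z(γ))`, then `Φ(⟦γ⟧, f; m) = ∫_{G⧸T} f(yγy⁻¹) d(ν∕t_T)` (★ `orbitalIntegral_atPoint` + ★ `orbitalIntegral_eq_integral_descConj_of_eq_centralizer`);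
  (D2) `OrbitalMeasureFamily.IsQuotientOf.classOrbitalIntegral_mk_eq_integral_descConj` — the same for ★ `IsQuotientOf` families with CONJUGATION-COHERENT torus data (★
  `IsQuotientOf.atPoint_eq_quotientMeasure_of_forall_map_conj_eq`; the shape A-p19's (K7-s)-arch road delivers: ★ `map_subgroupCongrHomeomorph_conj_centralizerTopFormHaar`);
  (D3) `OrbitalMeasureFamily.exists_classOrbitalIntegral_mk_eq_integral_descConj_smul_of_atPoint_eq` — the honest «IFF»: against ANY Haar `t_T` on `T` there is `κ > 0`
  (the Haar scalar factor of `ρ` carried to `T`) with `ρ = (κ • t_T) ∘ (T = Z(γ))` and the class orbital integral = the singular integral for `κ • t_T` — un-scaled equality iff `κ = 1`.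
* §2 PER CARRIER `G_w(β)` at a wall point `diag z₀` with reference `diag z₁` (★ `centralizer_circleDiagonal_eq_of_wall`, ★ `forall_mem_centralizer_circleDiagonal_comm_of_wall`):
  (A1) **`classOrbitalIntegral_mk_circleDiagonal_eq_integral_descConj_wall_of_atPoint_eq`** — RHS = J1's singular term TOKEN FOR TOKEN; (A2) its `IsQuotientOf` form; (A3) its Haar-change form.
NOT HERE: the Kottwitz-weighted forms (one `rw` by ★ `classOrbitalIntegral_classWeight_mul`), the global carrier `arch … 3 H′` (§1 applies by `exact`) and the global → per-place product
reduction at a singular class (J2 assembly). HONEST LABEL: HC_CM is proved only modulo the printed citations until rung 0 closes; this file pays nothing by itself.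

## References
* [Rogawski1990] J. D. Rogawski, *Automorphic Representations of Unitary Groups in Three Variables*, Ann. of Math. Stud. 123 (1990), §1.7 p. 6; §4.3 (4.3.1) p. 43; §8.2 pp. 122–124;
  §14.5 Lemma 14.5.2 (b) p. 239.
* [DeitmarEchterhoff2014] A. Deitmar, S. Echterhoff, *Principles of Harmonic Analysis*, 2nd ed. (2014), Thm. 1.5.3 (invariant quotient measure; uniqueness up to a scalar).
* [Kottwitz1988] R. E. Kottwitz, *Tamagawa numbers*, Ann. of Math. 127 (1988), Prop. 2 (compatible measures at the singular classes).
-/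

set_option autoImplicit false

noncomputable section

open MeasureTheory Measure NumberField NumberField.InfinitePlace
open Literature.MeasureTheory.Group
open scoped Matrix MatrixGroups NNReal

/-! ## §1 Generic: the class orbital integral of a Weil-form family over a fixed closed presentation of the centraliser -/

namespace Literature.NumberTheory.Automorphic

section Generic

variable {G : Type*} [Group G] [TopologicalSpace G] [IsTopologicalGroup G] [LocallyCompactSpace G]
  [SecondCountableTopology G] [T2Space G] [MeasurableSpace G] [BorelSpace G]
  [∀ γ : G, MeasurableSpace (G ⧸ Subgroup.centralizer ({γ} : Set G))]
  [∀ γ : G, BorelSpace (G ⧸ Subgroup.centralizer ({γ} : Set G))]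

/-- **(D1) THE CLASS ORBITAL INTEGRAL OF A WEIL-FORM FAMILY, READ OVER A FIXED CLOSED PRESENTATION `T = Z(γ)`.** If the family's measure at the point `γ` is the invariant
quotient measure `dν ∕ dρ` (`m.atPoint γ = quotientMeasure Z(γ) ρ ν`, `m ⟦γ⟧` invariant) and `T = Z(γ)` carries `t_T` with `ρ = t_T ∘ (T = Z(γ))`, then
`Φ(⟦γ⟧, f; m) = ∫_{G ⧸ T} f(y γ y⁻¹) d(ν ∕ t_T)` (★ `orbitalIntegral_atPoint`, ★ `orbitalIntegral_eq_integral_descConj_of_eq_centralizer`). [cite: Rogawski1990, §4.3 (4.3.1) p. 43; §1.7 p. 6]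
[cite: DeitmarEchterhoff2014, Thm. 1.5.3] -/
theorem OrbitalMeasureFamily.classOrbitalIntegral_mk_eq_integral_descConj_of_atPoint_eq (m : OrbitalMeasureFamily G) (γ : G)
    [SMulInvariantMeasure G (G ⧸ Subgroup.centralizer ({(Quotient.out (ConjClasses.mk γ) : G)} : Set G)) (m (ConjClasses.mk γ))]
    {ν : Measure G} [ν.IsHaarMeasure] [ν.IsMulRightInvariant]
    {ρ : Measure (Subgroup.centralizer ({γ} : Set G))} [ρ.IsHaarMeasure] [ρ.IsInvInvariant]
    (hq : m.atPoint γ = quotientMeasure (Subgroup.centralizer ({γ} : Set G)) ρ (isClosed_coe_centralizer_singleton γ) ν)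
    {T : Subgroup G} (h : T = Subgroup.centralizer ({γ} : Set G)) (hT : ∀ x ∈ T, x * γ = γ * x) (hTc : IsClosed (T : Set G))
    [MeasurableSpace (G ⧸ T)] [BorelSpace (G ⧸ T)]
    (tT : Measure T) [tT.IsHaarMeasure] [tT.IsInvInvariant] (hρ : ρ = tT.map (MulEquiv.subgroupCongr h)) (f : G → ℂ) :
    classOrbitalIntegral m f (ConjClasses.mk γ) = ∫ y, descConj γ T hT f y ∂(quotientMeasure T tT hTc ν) := by
  rw [← m.orbitalIntegral_atPoint γ f, hq]
  exact orbitalIntegral_eq_integral_descConj_of_eq_centralizer γ h hT hTc tT ρ hρ ν f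

/-- **(D2) THE SAME FOR `IsQuotientOf` FAMILIES WITH CONJUGATION-COHERENT TORUS DATA** (★ `OrbitalMeasureFamily.IsQuotientOf`: `m c = dν ∕ dt_{out c}` on the `P`-classes; `P`
conjugation-stable; `t` coherent under conjugation on the `P`-points — then at every `P`-point `m.atPoint γ = dν ∕ dt_γ`, ★ `atPoint_eq_quotientMeasure_of_forall_map_conj_eq`): for a
closed presentation `T = Z(γ)` with `t γ = t_T ∘ (T = Z(γ))`, `Φ(⟦γ⟧, f; m) = ∫_{G ⧸ T} f(y γ y⁻¹) d(ν ∕ t_T)`. [cite: Rogawski1990, §4.3 (4.3.1) p. 43; §1.7 p. 6]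
[cite: DeitmarEchterhoff2014, Thm. 1.5.3] -/
theorem OrbitalMeasureFamily.IsQuotientOf.classOrbitalIntegral_mk_eq_integral_descConj {P : G → Prop} {ν : Measure G} [ν.IsHaarMeasure]
    [ν.IsMulRightInvariant] {t : ∀ γ : G, Measure (Subgroup.centralizer ({γ} : Set G))} {m : OrbitalMeasureFamily G}
    (hm : m.IsQuotientOf P ν t) (hP : ∀ (γ₁ q : G), P γ₁ → P (q * γ₁ * q⁻¹))
    (hcoh : ∀ (γ₁ γ₂ q : G) (hq : (MulAut.conj q : G ≃* G) γ₁ = γ₂), P γ₁ →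
      Measure.map (subgroupCongrHomeomorph (MulAut.conj q : G ≃* G) (Subgroup.centralizer ({γ₁} : Set G))
        (Subgroup.centralizer ({γ₂} : Set G)) (forall_apply_mem_centralizer_singleton_iff_of_eq (MulAut.conj q : G ≃* G) hq)
        (continuous_mulAutConj q) (continuous_mulAutConj_symm q)) (t γ₁) = t γ₂)
    (γ : G) (hγ : P γ)
    {T : Subgroup G} (h : T = Subgroup.centralizer ({γ} : Set G)) (hT : ∀ x ∈ T, x * γ = γ * x) (hTc : IsClosed (T : Set G))
    [MeasurableSpace (G ⧸ T)] [BorelSpace (G ⧸ T)]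
    (tT : Measure T) [tT.IsHaarMeasure] [tT.IsInvInvariant] (htT : t γ = tT.map (MulEquiv.subgroupCongr h)) (f : G → ℂ) :
    classOrbitalIntegral m f (ConjClasses.mk γ) = ∫ y, descConj γ T hT f y ∂(quotientMeasure T tT hTc ν) := by
  obtain ⟨hth, hti, hq⟩ := hm.atPoint_eq_quotientMeasure_of_forall_map_conj_eq hP hcoh γ hγ
  -- the class measure `m ⟦γ⟧` is the Weil quotient at the representative, hence invariant
  have hPout : P (Quotient.out (ConjClasses.mk γ)) := by
    rw [out_conjClassesMk_eq_conj γ]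
    exact hP γ _ hγ
  obtain ⟨ht1, ht2, hmc⟩ := hm _ hPout
  haveI : SMulInvariantMeasure G (G ⧸ Subgroup.centralizer ({(Quotient.out (ConjClasses.mk γ) : G)} : Set G)) (m (ConjClasses.mk γ)) := by
    rw [hmc]
    exact smulInvariantMeasure_quotientMeasure _ _ _ ν
  exact m.classOrbitalIntegral_mk_eq_integral_descConj_of_atPoint_eq γ hq h hT hTc tT htT f

/-- **(D3) AGAINST ANY HAAR MEASURE ON `T` — the compatibility constant.** Under the hypotheses of (D1) but with an ARBITRARY inversion-invariant Haar measure `t_T` on the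
presentation `T = Z(γ)`: there is `κ > 0` (the Haar scalar factor of the family's torus measure carried to `T` against `t_T`) with `ρ = (κ • t_T) ∘ (T = Z(γ))` and
`Φ(⟦γ⟧, f; m) = ∫_{G ⧸ T} f(y γ y⁻¹) d(ν ∕ (κ • t_T))` — the two singular orbital integrals AGREE (un-scaled) iff `κ = 1`, i.e. iff the family's mass at `⟦γ⟧` IS the
`t_T`-normalised quotient measure («compatible measures», §1.7). [cite: Rogawski1990, §1.7 p. 6; §4.3 (4.3.1) p. 43] [cite: DeitmarEchterhoff2014, Thm. 1.5.3] -/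
theorem OrbitalMeasureFamily.exists_classOrbitalIntegral_mk_eq_integral_descConj_smul_of_atPoint_eq (m : OrbitalMeasureFamily G) (γ : G)
    [SMulInvariantMeasure G (G ⧸ Subgroup.centralizer ({(Quotient.out (ConjClasses.mk γ) : G)} : Set G)) (m (ConjClasses.mk γ))]
    {ν : Measure G} [ν.IsHaarMeasure] [ν.IsMulRightInvariant]
    {ρ : Measure (Subgroup.centralizer ({γ} : Set G))} [ρ.IsHaarMeasure] [ρ.IsInvInvariant]
    (hq : m.atPoint γ = quotientMeasure (Subgroup.centralizer ({γ} : Set G)) ρ (isClosed_coe_centralizer_singleton γ) ν)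
    {T : Subgroup G} (h : T = Subgroup.centralizer ({γ} : Set G)) (hT : ∀ x ∈ T, x * γ = γ * x) (hTc : IsClosed (T : Set G))
    [MeasurableSpace (G ⧸ T)] [BorelSpace (G ⧸ T)]
    (tT : Measure T) [tT.IsHaarMeasure] [tT.IsInvInvariant] (f : G → ℂ) :
    ∃ κ : ℝ≥0, κ ≠ 0 ∧ ∃ (_ : (κ • tT).IsHaarMeasure) (_ : (κ • tT).IsInvInvariant),
      ρ = (κ • tT).map (MulEquiv.subgroupCongr h) ∧
        classOrbitalIntegral m f (ConjClasses.mk γ) = ∫ y, descConj γ T hT f y ∂(quotientMeasure T (κ • tT) hTc ν) := by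
  haveI : LocallyCompactSpace T := hTc.isClosedEmbedding_subtypeVal.locallyCompactSpace
  haveI : SecondCountableTopology T := TopologicalSpace.Subtype.secondCountableTopology _
  -- `ρ` carried to `T` along the identity `T = Z(γ)` is a Haar measure, hence `κ • t_T`
  have he : Continuous (MulEquiv.subgroupCongr h).symm := continuous_subtype_val.subtype_mk _
  have hes : Continuous (MulEquiv.subgroupCongr h).symm.symm := continuous_subtype_val.subtype_mk _
  haveI hρT : (ρ.map (MulEquiv.subgroupCongr h).symm).IsHaarMeasure := (MulEquiv.subgroupCongr h).symm.isHaarMeasure_map ρ he hes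
  have hκ : Measure.haarScalarFactor (ρ.map (MulEquiv.subgroupCongr h).symm) tT ≠ 0 :=
    (Measure.haarScalarFactor_pos_of_isHaarMeasure _ _).ne'
  haveI h1 : (Measure.haarScalarFactor (ρ.map (MulEquiv.subgroupCongr h).symm) tT • tT).IsHaarMeasure := IsHaarMeasure.nnreal_smul tT hκ
  haveI h2 : (Measure.haarScalarFactor (ρ.map (MulEquiv.subgroupCongr h).symm) tT • tT).IsInvInvariant := isInvInvariant_nnreal_smul tT _
  have hρT' : ρ.map (MulEquiv.subgroupCongr h).symm = Measure.haarScalarFactor (ρ.map (MulEquiv.subgroupCongr h).symm) tT • tT :=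
    isHaarMeasure_eq_haarScalarFactor_smul tT _
  -- `ρ = (κ • t_T) ∘ (T = Z(γ))`: carry back along the identity
  have hme : Measurable (⇑(MulEquiv.subgroupCongr h) : T → Subgroup.centralizer ({γ} : Set G)) :=
    (continuous_subtype_val.subtype_mk _ : Continuous (⇑(MulEquiv.subgroupCongr h) : T → Subgroup.centralizer ({γ} : Set G))).measurable
  have hρ : ρ = (Measure.haarScalarFactor (ρ.map (MulEquiv.subgroupCongr h).symm) tT • tT).map (MulEquiv.subgroupCongr h) := by
    rw [← hρT', Measure.map_map hme he.measurable]
    have hid : ((⇑(MulEquiv.subgroupCongr h) : T → Subgroup.centralizer ({γ} : Set G)) ∘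
        (⇑(MulEquiv.subgroupCongr h).symm : Subgroup.centralizer ({γ} : Set G) → T)) = id :=
      funext fun x => (MulEquiv.subgroupCongr h).apply_symm_apply x
    rw [hid, Measure.map_id]
  exact ⟨_, hκ, h1, h2, hρ, m.classOrbitalIntegral_mk_eq_integral_descConj_of_atPoint_eq γ hq h hT hTc _ hρ f⟩

end Generic

end Literature.NumberTheory.Automorphic

/-! ## §2 The carrier `G_w(β) = U(σ_w diag β)(ℂ)` at a wall point `diag z₀`, reference wall point `diag z₁` -/

namespace Literature.NumberTheory.Rogawski1990

open Literature.NumberTheory.Automorphic Literature.NumberTheory.Automorphic.UnitaryGroup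

section Wall

variable (L : Type) [Field L] (β : Fin 3 → L) (w : {w : InfinitePlace L // IsComplex w})
  [MeasurableSpace (GL (Fin 3) ℂ)] [BorelSpace (GL (Fin 3) ℂ)]
  [∀ g : archLocal L 3 (Matrix.diagonal β) w, MeasurableSpace (archLocal L 3 (Matrix.diagonal β) w ⧸ Subgroup.centralizer ({g} : Set (archLocal L 3 (Matrix.diagonal β) w)))]
  [∀ g : archLocal L 3 (Matrix.diagonal β) w, BorelSpace (archLocal L 3 (Matrix.diagonal β) w ⧸ Subgroup.centralizer ({g} : Set (archLocal L 3 (Matrix.diagonal β) w)))]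
  [LocallyCompactSpace (archLocal L 3 (Matrix.diagonal β) w)] [SecondCountableTopology (archLocal L 3 (Matrix.diagonal β) w)]
  (ν : Measure (archLocal L 3 (Matrix.diagonal β) w)) [ν.IsHaarMeasure] [ν.IsMulRightInvariant]
  {z₁ z₀ : Fin 3 → Circle} (h02 : z₁ 0 = z₁ 2) (h01 : z₁ 0 ≠ z₁ 1) (h02' : z₀ 0 = z₀ 2) (h01' : z₀ 0 ≠ z₀ 1)

/-- **(A1) THE SINGULAR DICTIONARY ON `G_w(β)`.** At a point `diag z₀` of the open wall `{z 0 = z 2 ≠ z 1}`, for an orbital measure family `m` whose measure at the point is the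
Weil quotient `dν ∕ dρ` and a Haar measure `νH` chosen ONCE on the wall subgroup `H_w = Z(diag z₁)` (★ `centralizer_circleDiagonal_eq_of_wall`: `Z(diag z₁) = Z(diag z₀)`) with
`ρ = νH ∘ (H_w = Z(diag z₀))`: `Φ(⟦diag z₀⟧, f; m) = ∫_{G_w ⧸ H_w} f(y · diag z₀ · y⁻¹) d(ν ∕ νH)` — the right-hand side is the singular term of ★ J1
`exists_tendsto_deriv_sin_mul_sum_integral_comp_conj_splitCurve_comp_perm` token for token. [cite: Rogawski1990, §8.2 pp. 122–124; §4.3 (4.3.1) p. 43] [cite: DeitmarEchterhoff2014, Thm. 1.5.3] -/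
theorem classOrbitalIntegral_mk_circleDiagonal_eq_integral_descConj_wall_of_atPoint_eq
    (m : OrbitalMeasureFamily (archLocal L 3 (Matrix.diagonal β) w))
    [SMulInvariantMeasure (archLocal L 3 (Matrix.diagonal β) w)
      (archLocal L 3 (Matrix.diagonal β) w ⧸ Subgroup.centralizer ({(Quotient.out (ConjClasses.mk
        (⟨circleDiagonal 3 z₀, circleDiagonal_mem_archLocal_diagonal L 3 β w z₀⟩ : archLocal L 3 (Matrix.diagonal β) w)) : archLocal L 3 (Matrix.diagonal β) w)} :
          Set (archLocal L 3 (Matrix.diagonal β) w)))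
      (m (ConjClasses.mk (⟨circleDiagonal 3 z₀, circleDiagonal_mem_archLocal_diagonal L 3 β w z₀⟩ : archLocal L 3 (Matrix.diagonal β) w)))]
    {ρ : Measure (Subgroup.centralizer ({(⟨circleDiagonal 3 z₀, circleDiagonal_mem_archLocal_diagonal L 3 β w z₀⟩ : archLocal L 3 (Matrix.diagonal β) w)} :
      Set (archLocal L 3 (Matrix.diagonal β) w)))} [ρ.IsHaarMeasure] [ρ.IsInvInvariant]
    (hq : m.atPoint (⟨circleDiagonal 3 z₀, circleDiagonal_mem_archLocal_diagonal L 3 β w z₀⟩ : archLocal L 3 (Matrix.diagonal β) w) =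
      quotientMeasure _ ρ (isClosed_coe_centralizer_singleton _) ν)
    (νH : Measure (Subgroup.centralizer ({(⟨circleDiagonal 3 z₁, circleDiagonal_mem_archLocal_diagonal L 3 β w z₁⟩ : archLocal L 3 (Matrix.diagonal β) w)} :
      Set (archLocal L 3 (Matrix.diagonal β) w)))) [νH.IsHaarMeasure] [νH.IsInvInvariant]
    (hρ : ρ = νH.map (MulEquiv.subgroupCongr (centralizer_circleDiagonal_eq_of_wall L β w h02 h01 h02' h01')))
    (f : archLocal L 3 (Matrix.diagonal β) w → ℂ) :
    classOrbitalIntegral m f (ConjClasses.mk (⟨circleDiagonal 3 z₀, circleDiagonal_mem_archLocal_diagonal L 3 β w z₀⟩ : archLocal L 3 (Matrix.diagonal β) w)) =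
      ∫ y, descConj (⟨circleDiagonal 3 z₀, circleDiagonal_mem_archLocal_diagonal L 3 β w z₀⟩ : archLocal L 3 (Matrix.diagonal β) w)
        (Subgroup.centralizer ({(⟨circleDiagonal 3 z₁, circleDiagonal_mem_archLocal_diagonal L 3 β w z₁⟩ : archLocal L 3 (Matrix.diagonal β) w)} :
          Set (archLocal L 3 (Matrix.diagonal β) w)))
        (forall_mem_centralizer_circleDiagonal_comm_of_wall L β w h02 h01 h02' h01') f y
        ∂(quotientMeasure _ νH (isClosed_coe_centralizer_singleton _) ν) := by
  exact OrbitalMeasureFamily.classOrbitalIntegral_mk_eq_integral_descConj_of_atPoint_eq m _ hq (centralizer_circleDiagonal_eq_of_wall L β w h02 h01 h02' h01')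
    (forall_mem_centralizer_circleDiagonal_comm_of_wall L β w h02 h01 h02' h01') (isClosed_coe_centralizer_singleton _) νH hρ f

/-- **(A2) THE SINGULAR DICTIONARY ON `G_w(β)` FOR `IsQuotientOf` FAMILIES WITH COHERENT TORUS DATA** (the shape the (K7-s)-arch road delivers: `t` = transported top-form Haar,
coherent by ★ `map_subgroupCongrHomeomorph_conj_centralizerTopFormHaar`-type lemmas): with `P (diag z₀)` and `t (diag z₀) = νH ∘ (H_w = Z(diag z₀))`,
`Φ(⟦diag z₀⟧, f; m) = ∫_{G_w ⧸ H_w} f(y · diag z₀ · y⁻¹) d(ν ∕ νH)`. [cite: Rogawski1990, §8.2 pp. 122–124; §4.3 (4.3.1) p. 43; §1.7 p. 6] [cite: DeitmarEchterhoff2014, Thm. 1.5.3] -/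
theorem IsQuotientOf.classOrbitalIntegral_mk_circleDiagonal_eq_integral_descConj_wall
    {P : archLocal L 3 (Matrix.diagonal β) w → Prop}
    {t : ∀ g : archLocal L 3 (Matrix.diagonal β) w, Measure (Subgroup.centralizer ({g} : Set (archLocal L 3 (Matrix.diagonal β) w)))}
    {m : OrbitalMeasureFamily (archLocal L 3 (Matrix.diagonal β) w)}
    (hm : m.IsQuotientOf P ν t)
    (hP : ∀ (γ₁ q : archLocal L 3 (Matrix.diagonal β) w), P γ₁ → P (q * γ₁ * q⁻¹))
    (hcoh : ∀ (γ₁ γ₂ q : archLocal L 3 (Matrix.diagonal β) w) (hq : (MulAut.conj q : _ ≃* _) γ₁ = γ₂), P γ₁ →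
      Measure.map (subgroupCongrHomeomorph (MulAut.conj q : _ ≃* _) (Subgroup.centralizer ({γ₁} : Set (archLocal L 3 (Matrix.diagonal β) w)))
        (Subgroup.centralizer ({γ₂} : Set (archLocal L 3 (Matrix.diagonal β) w)))
        (forall_apply_mem_centralizer_singleton_iff_of_eq (MulAut.conj q : _ ≃* _) hq)
        (continuous_mulAutConj q) (continuous_mulAutConj_symm q)) (t γ₁) = t γ₂)
    (hz₀ : P (⟨circleDiagonal 3 z₀, circleDiagonal_mem_archLocal_diagonal L 3 β w z₀⟩ : archLocal L 3 (Matrix.diagonal β) w))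
    (νH : Measure (Subgroup.centralizer ({(⟨circleDiagonal 3 z₁, circleDiagonal_mem_archLocal_diagonal L 3 β w z₁⟩ : archLocal L 3 (Matrix.diagonal β) w)} :
      Set (archLocal L 3 (Matrix.diagonal β) w)))) [νH.IsHaarMeasure] [νH.IsInvInvariant]
    (ht : t (⟨circleDiagonal 3 z₀, circleDiagonal_mem_archLocal_diagonal L 3 β w z₀⟩ : archLocal L 3 (Matrix.diagonal β) w) =
      νH.map (MulEquiv.subgroupCongr (centralizer_circleDiagonal_eq_of_wall L β w h02 h01 h02' h01')))
    (f : archLocal L 3 (Matrix.diagonal β) w → ℂ) :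
    classOrbitalIntegral m f (ConjClasses.mk (⟨circleDiagonal 3 z₀, circleDiagonal_mem_archLocal_diagonal L 3 β w z₀⟩ : archLocal L 3 (Matrix.diagonal β) w)) =
      ∫ y, descConj (⟨circleDiagonal 3 z₀, circleDiagonal_mem_archLocal_diagonal L 3 β w z₀⟩ : archLocal L 3 (Matrix.diagonal β) w)
        (Subgroup.centralizer ({(⟨circleDiagonal 3 z₁, circleDiagonal_mem_archLocal_diagonal L 3 β w z₁⟩ : archLocal L 3 (Matrix.diagonal β) w)} :
          Set (archLocal L 3 (Matrix.diagonal β) w)))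
        (forall_mem_centralizer_circleDiagonal_comm_of_wall L β w h02 h01 h02' h01') f y
        ∂(quotientMeasure _ νH (isClosed_coe_centralizer_singleton _) ν) := by
  exact hm.classOrbitalIntegral_mk_eq_integral_descConj hP hcoh _ hz₀ (centralizer_circleDiagonal_eq_of_wall L β w h02 h01 h02' h01')
    (forall_mem_centralizer_circleDiagonal_comm_of_wall L β w h02 h01 h02' h01') (isClosed_coe_centralizer_singleton _) νH ht f

/-- **(A3) THE (V6)-COMPATIBILITY STATEMENT ON `G_w(β)`.** For ANY inversion-invariant Haar measure `νH` on the wall subgroup `H_w = Z(diag z₁)` and a family in Weil form `dν ∕ dρ` at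
`diag z₀`: there is `κ > 0` with `ρ = (κ • νH) ∘ (H_w = Z(diag z₀))` and `Φ(⟦diag z₀⟧, f; m) = ∫_{G_w ⧸ H_w} f(y · diag z₀ · y⁻¹) d(ν ∕ (κ • νH))` — the closer's singular orbital integral and
the letter's `S_Θ(z₀; ν, νH)` agree iff `κ = 1`. [cite: Rogawski1990, §1.7 p. 6; §4.3 (4.3.1) p. 43; §8.2 pp. 122–124] [cite: Kottwitz1988, Prop. 2] [cite: DeitmarEchterhoff2014, Thm. 1.5.3] -/
theorem exists_classOrbitalIntegral_mk_circleDiagonal_eq_integral_descConj_wall_smul_of_atPoint_eq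
    (m : OrbitalMeasureFamily (archLocal L 3 (Matrix.diagonal β) w))
    [SMulInvariantMeasure (archLocal L 3 (Matrix.diagonal β) w)
      (archLocal L 3 (Matrix.diagonal β) w ⧸ Subgroup.centralizer ({(Quotient.out (ConjClasses.mk
        (⟨circleDiagonal 3 z₀, circleDiagonal_mem_archLocal_diagonal L 3 β w z₀⟩ : archLocal L 3 (Matrix.diagonal β) w)) : archLocal L 3 (Matrix.diagonal β) w)} :
          Set (archLocal L 3 (Matrix.diagonal β) w)))
      (m (ConjClasses.mk (⟨circleDiagonal 3 z₀, circleDiagonal_mem_archLocal_diagonal L 3 β w z₀⟩ : archLocal L 3 (Matrix.diagonal β) w)))]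
    {ρ : Measure (Subgroup.centralizer ({(⟨circleDiagonal 3 z₀, circleDiagonal_mem_archLocal_diagonal L 3 β w z₀⟩ : archLocal L 3 (Matrix.diagonal β) w)} :
      Set (archLocal L 3 (Matrix.diagonal β) w)))} [ρ.IsHaarMeasure] [ρ.IsInvInvariant]
    (hq : m.atPoint (⟨circleDiagonal 3 z₀, circleDiagonal_mem_archLocal_diagonal L 3 β w z₀⟩ : archLocal L 3 (Matrix.diagonal β) w) =
      quotientMeasure _ ρ (isClosed_coe_centralizer_singleton _) ν)
    (νH : Measure (Subgroup.centralizer ({(⟨circleDiagonal 3 z₁, circleDiagonal_mem_archLocal_diagonal L 3 β w z₁⟩ : archLocal L 3 (Matrix.diagonal β) w)} :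
      Set (archLocal L 3 (Matrix.diagonal β) w)))) [νH.IsHaarMeasure] [νH.IsInvInvariant]
    (f : archLocal L 3 (Matrix.diagonal β) w → ℂ) :
    ∃ κ : ℝ≥0, κ ≠ 0 ∧ ∃ (_ : (κ • νH).IsHaarMeasure) (_ : (κ • νH).IsInvInvariant),
      ρ = (κ • νH).map (MulEquiv.subgroupCongr (centralizer_circleDiagonal_eq_of_wall L β w h02 h01 h02' h01')) ∧
      classOrbitalIntegral m f (ConjClasses.mk (⟨circleDiagonal 3 z₀, circleDiagonal_mem_archLocal_diagonal L 3 β w z₀⟩ : archLocal L 3 (Matrix.diagonal β) w)) =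
        ∫ y, descConj (⟨circleDiagonal 3 z₀, circleDiagonal_mem_archLocal_diagonal L 3 β w z₀⟩ : archLocal L 3 (Matrix.diagonal β) w)
          (Subgroup.centralizer ({(⟨circleDiagonal 3 z₁, circleDiagonal_mem_archLocal_diagonal L 3 β w z₁⟩ : archLocal L 3 (Matrix.diagonal β) w)} :
            Set (archLocal L 3 (Matrix.diagonal β) w)))
          (forall_mem_centralizer_circleDiagonal_comm_of_wall L β w h02 h01 h02' h01') f y
          ∂(quotientMeasure _ (κ • νH) (isClosed_coe_centralizer_singleton _) ν) :=
  OrbitalMeasureFamily.exists_classOrbitalIntegral_mk_eq_integral_descConj_smul_of_atPoint_eq m _ hq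
    (centralizer_circleDiagonal_eq_of_wall L β w h02 h01 h02' h01') (forall_mem_centralizer_circleDiagonal_comm_of_wall L β w h02 h01 h02' h01')
    (isClosed_coe_centralizer_singleton _) νH f

end Wall

end Literature.NumberTheory.Rogawski1990

end
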